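import Summits.AtomisticToContinuum.HydrodynamicLimit.Theses.LambertianContactSwap
import Summits.AtomisticToContinuum.HydrodynamicLimit.Theorems.LambertianContactSwapLambertianEulerLiouville
import Summits.AtomisticToContinuum.HydrodynamicLimit.Theorems.JParityClosureOddContactSymmetryGibbsInvariance
import Summits.AtomisticToContinuum.HydrodynamicLimit.Theorems.LambertianContactSwapLocalGibbsProbability
import Literature.MathematicalPhysics.KineticTheory.LambertianHardSphereFlow
import HarnessLib

/-!
# `SwapGap` (stmt-AtomisticToContinuum-11850), line `Sketch`: the EQUILIBRIUM RUNG of stub S1 (`RelEntSwap`)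

Helper file (`--supports stmt-AtomisticToContinuum-11850`) of line `Sketch` (card `entropy-relative-to-lambertian-law`) for the crux
`Summit.AtomisticToContinuum.HydrodynamicLimit.Theses.LambertianContactSwap.SwapGap`, registered helper stub
`stub_relEntSwap_equilibrium` of the lead's skeleton v7: on the equilibrium rung (constant profiles `a, θ > 0`, `u`) the research
stub S1 holds EXACTLY — the homogeneous Gibbs law `G_N` is invariant under every hard-sphere flow (`map_flow_localGibbsLaw_const`)
and under the Lambertian flow in law (`gibbsInvarianceLambda_holds`), so `p_t = q_t = G_N` and `KL(p_t ‖ q_t) = 0` for every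
`N`, every flow and every `t ≥ 0`.  Hence no equilibrium witness can refute S1: it is a purely non-equilibrium statement.

prover-line-stmt-AtomisticToContinuum-11850-c3-0, cycle 4.
-/

noncomputable section

open MeasureTheory Filter Set Topology InformationTheory
open scoped ENNReal

namespace Summit.AtomisticToContinuum.HydrodynamicLimit.Theorems

open Literature.Analysis.FluidPDE Literature.MathematicalPhysics.KineticTheory
open Summit.AtomisticToContinuum.HydrodynamicLimit.Theses.LambertianContactSwap

/-- **Equilibrium rung of S1 (`RelEntSwap`)**: for `0 < σ < 1/2`, constant profiles `a, θ > 0`, `u`, every `N`, every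
hard-sphere flow `Φ` and every `t ≥ 0`, the deterministic law `(Φ_t)_* G_N` and the Lambertian law `(Λ_t)_* (G_N ⊗ γ^ℕ)` started
from the homogeneous Gibbs law `G_N = localGibbsLaw σ a u θ N Φ` coincide (both equal `G_N`), so their relative entropy vanishes.
[folklore] -/
theorem stub_relEntSwap_equilibrium :
    ∀ σ : ℝ, 0 < σ → σ < 2⁻¹ → ∀ (a θ : ℝ) (u : V3), 0 < a → 0 < θ →
      ∀ (N : ℕ) (Φ : HardSphereFlow (Torus.geometry (Fin 3)) (hsDiameter σ N) (N + 1)) (t : ℝ), 0 ≤ t →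
        klDiv ((localGibbsLaw σ (fun _ => a) (fun _ => u) (fun _ => θ) N Φ).map (Φ.flow t))
          (((localGibbsLaw σ (fun _ => a) (fun _ => u) (fun _ => θ) N Φ).prod (lambertNoise (Fin 3))).map
            (fun p => lambertFlow (Torus.geometry (Fin 3)) (hsDiameter σ N) p.2 p.1 t)) = 0 := by
  intro σ hσ hσ' a θ u ha hθ N Φ t ht
  rw [map_flow_localGibbsLaw_const σ a θ u N Φ t,
    LambertianContactSwapLambertianEulerLiouville.gibbsInvarianceLambda_holds σ hσ hσ' N a θ u ha hθ Φ t ht]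
  haveI := isProbabilityMeasure_localGibbsLaw (a₀ := fun _ => a) (θ₀ := fun _ => θ)
    (u₀ := fun _ => u) continuous_const continuous_const continuous_const (fun _ => ha)
    (fun _ => hθ) (by linarith : σ ≤ 1 / 2) N Φ
  exact klDiv_self _

end Summit.AtomisticToContinuum.HydrodynamicLimit.Theorems
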